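import Mathlib
import HarnessLib
import Summits.QuantumAdvantage.QuantumAdvantage.Theses.RegulatorThird
import Literature.Computability.Complexity.StringEquality
import Literature.Computability.Complexity.ReductionsProofs

/-!
# Crux `OneThirdFP` (stmt-QuantumAdvantage-15982) — the strategist's typed split (glue for `route edit --split`; to be landed verbatim by a prover as Theorems/RegulatorThirdOneThirdFPSplit.lean)

Glue for the DECOMPOSITION of the crux `Summit.QuantumAdvantage.QuantumAdvantage.Theses.RegulatorThird.OneThirdFP`
(route QuantumAdvantage/RegulatorThird, rank 2: "some `g ∈ FP` maps `⟨bin s, bin r⟩` — `s > 1` square-free, `r` within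
`1` of the regulator of `ℚ(√s)` — to the code of the LEAST representative `(A*, B*, n*)` (key `|A|+|B|+n`, then
lexicographic) of `η K^{×3} ∪ η⁻¹ K^{×3}`, `η` the fundamental unit") into three leaf statements, recorded by the
crux-strategist seat `planner-cstrat-stmt-QuantumAdvantage-15982-r1-0` (re-audit bin RESTATED; the BC2 premise probe
`OneThirdFP → QuantumAdvantage` FAILS — `exact?` "could not close the goal", `aesop` exhaustive-search failure — so the
crux is not summit-strength; the split is filed on its own merits, see WHY below).

WHY THIS CUT.  Write a class member as `x = η^{±1} w³`, `(w) = 𝔞 𝔟⁻¹` (coprime integral ideals).  For the LEAST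
triple, split / inert / rational-cube parts of `𝔟` never occur (multiplying `w` by `q^v` keeps the numerator `A + B√s`
and divides `n` by `q^{3v}`) and a ramified prime occurs in `𝔟` with exponent `≤ 1`; hence `n* = b²` (or `2b²` when
`s ≡ 1 (mod 4)` and `b² x` is half-integral) with `b` the square-free product of the ramified primes of `𝔟`, and
`𝔞` lies in the AMBIGUOUS ideal class `[𝔟]`.  Brute force over all 148 square-free `s ≤ 240`
(`Cruxes/OneThirdFP/SPLIT-RATIONALE.md`, scripts `compute/leastrep.py`, `compute/leastrep2.py` attached as evidence on stmt-QuantumAdvantage-15982): the least triple has such a ramified denominator in 51 fields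
(`n* ∈ {4, 9, 18, 25}`), and in 17 of them (`s = 70, 74, 78, 87, 95, 111, 114, 115, 130, 138, 154, 183, 190, 202, 203,
219, 231`) the class `[𝔟]` is NOT principal — its cycle is reachable only from the explicit ideal `(b, √s)`, i.e.
from a factor `b ∣ 2s` (ambiguous classes ↔ factorisations of the discriminant: Cohen 1993 §8.6–8.7, Shanks 1971,
Schoof 1982); `b` up to `≈ s^{3/8}` is eligible (cost `b²` additive, `√b` multiplicative against a cycle minimum that
fluctuates by a factor `> 7` across fields).  So the route's canonical object leaks genus (2-torsion) data through its
denominator, and the crux's canonicalisation step ("every small representative comes from a PRINCIPAL ideal near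
`R/3`") is false as sketched.  The split isolates exactly this:

CHILDREN (the three hypotheses below, verbatim the `statement`s filed with `route edit --split OneThirdFP`):
* `LeastRepDenominator` (support, arithmetic, M): every least triple has `n = b²` or `n = 2 b²` with `b` square-free,
  `b ∣ 2s` — the lemma above; it is what makes the ideal `𝔟 = (b, √s)·(2-adjustment)` explicit from `n*` alone.
* `LeastDenominatorFP` (crux, rank 2 — THE EXPOSED CORE): the denominator `n*` of the least triple is `FP`-computable
  from `⟨bin s, bin r⟩`.  Equivalent to locating the optimal ambiguous class; with `(s, ⌊R⌉)` alone the principal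
  cycle yields at most the one ambiguous ideal at distance `R/2`; no classical method reaches a non-principal ambiguous
  class without a factor of `s`.  A consequence of `OneThirdFP` (project the `n`-field), used toward it.
* `CanonicalRepGivenDenominatorFP` (crux, rank 3 — the infrastructure theorem): given `n*` as advice (promise: the
  ramified shape), the least triple is `FP`-computable from `⟨⟨bin s, bin r⟩, bin n*⟩`: navigate the cycle of `[𝔟]`
  to the two 3-division targets by giant steps (`r`), recover each candidate `n* η^{±1} w³` exactly from residues
  (compact-representation arithmetic, Jacobson–Williams 2008 Ch. 12 = tree fact
  `JacobsonWilliams2008_unitResidue_mem_FP_holds`), enumerate the `O(log s)` lattice minima window, compare keys.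
  A consequence of `OneThirdFP` (ignore the advice), used toward it.

THEOREM: `oneThirdFP_of_subs : LeastRepDenominator → LeastDenominatorFP → CanonicalRepGivenDenominatorFP → OneThirdFP`
(arrow form, hypotheses verbatim = the registered children, so `--glue-by` applies): the composite machine
`g ∘ fanoutFn id f : z ↦ g ⟨z, f z⟩` is in `FP` (`comp_mem_FP`, `fanoutFn_mem_FP`, `PolyTimeComputable.id`), and on
`z = ⟨bin s, bin r⟩` its output is `g ⟨z, bin n*⟩ = code(A*, B*, n*)` by the three specifications (the arithmetic
child discharges the advice promise).  HONESTY: `OneThirdFP ↔ (LeastDenominatorFP ∧ CanonicalRepGivenDenominatorFP)`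
given the support lemma; neither FP child alone gives the crux (probes `Xᵢ → OneThirdFP`, `Xᵢ → QuantumAdvantage`:
`exact?` could not close, `aesop` exhaustive-search failure, `simpa` heartbeat timeout, 12/12 failed); the cut is along
the certificate "which ambiguous class", not along a conjunction of the crux with itself.  No new definitions.
-/

-- `Summit.<Summit>.<Problem>` is the mandated summit-side namespace (CONVENTIONS §2); for the single-conjunct
-- summit `QuantumAdvantage` the two coincide, so the duplicate is deliberate.
set_option linter.dupNamespace false

namespace Summit.QuantumAdvantage.QuantumAdvantage.Theorems

open Literature.Computability.Complexity

/-- **The typed split of `OneThirdFP`.**  If (i) least representatives have ramified denominators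
(`LeastRepDenominator`), (ii) the denominator of the least representative is `FP`-computable from `⟨bin s, bin r⟩`
(`LeastDenominatorFP`) and (iii) the least representative is `FP`-computable from `⟨⟨bin s, bin r⟩, bin n*⟩`
(`CanonicalRepGivenDenominatorFP`), then `OneThirdFP`: run (ii), feed its output to (iii) — the composite
`g ∘ fanoutFn id f` is polynomial-time by closure of `FP` under fan-out and composition, and correct by the three
specifications. [Arora–Barak 2009, §1.3 (closure of FP under composition)] [folklore] -/
theorem oneThirdFP_of_subs :
    (∀ (s : ℕ), Squarefree s → 1 < s → ∀ (A B : ℤ) (n : ℕ), ((0 < n ∧ ∀ (K : Type) [Field K] [NumberField K], Module.finrank ℚ K = 2 → ∀ α : K, α ^ 2 = (s : K) → ∀ u : (NumberField.RingOfIntegers K)ˣ, (∀ v : (NumberField.RingOfIntegers K)ˣ, ∃ m : ℤ, v = u ^ m ∨ v = -(u ^ m)) → ∃ z : K, z ≠ 0 ∧ (((A : K) + (B : K) * α) / (n : K) = ((u : NumberField.RingOfIntegers K) : K) * z ^ 3 ∨ ((A : K) + (B : K) * α) / (n : K) = ((u⁻¹ : (NumberField.RingOfIntegers K)ˣ) :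 NumberField.RingOfIntegers K) * z ^ 3)) ∧ ∀ (A' B' : ℤ) (n' : ℕ), (0 < n' ∧ ∀ (K : Type) [Field K] [NumberField K], Module.finrank ℚ K = 2 → ∀ α : K, α ^ 2 = (s : K) → ∀ u : (NumberField.RingOfIntegers K)ˣ, (∀ v : (NumberField.RingOfIntegers K)ˣ, ∃ m : ℤ, v = u ^ m ∨ v = -(u ^ m)) → ∃ z : K, z ≠ 0 ∧ (((A' : K) + (B' : K) * α) / (n' : K) = ((u : NumberField.RingOfIntegers K) : K) * z ^ 3 ∨ ((A' : K) + (B' : K) * α) / (n' : K) = ((u⁻¹ : (NumberField.RingOfIntegers K)ˣ) : NumberField.RingOfIntegers K) * z ^ 3)) → (|A| + |B| + n < |A'| + |B'| + n' ∨ (|A| + |B| + n = |A'| + |B'| + n' ∧ (A < A' ∨ (A = A' ∧ (B < B' ∨ (B = B' ∧ n ≤ n'))))))) → ∃ b : ℕ, Squarefree b ∧ b ∣ 2 * s ∧ (n = b ^ 2 ∨ n = 2 * b ^ 2)) →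
    (∃ f ∈ Literature.Computability.Complexity.FP, ∀ (s r : ℕ), Squarefree s → 1 < s → (∀ (K : Type) [Field K] [NumberField K], Module.finrank ℚ K = 2 → (∃ α : K, α ^ 2 = (s : K)) → |NumberField.Units.regulator K - (r : ℝ)| ≤ 1) → ∀ (A B : ℤ) (n : ℕ), ((0 < n ∧ ∀ (K : Type) [Field K] [NumberField K], Module.finrank ℚ K = 2 → ∀ α : K, α ^ 2 = (s : K) → ∀ u : (NumberField.RingOfIntegers K)ˣ, (∀ v : (NumberField.RingOfIntegers K)ˣ, ∃ m : ℤ, v = u ^ m ∨ v = -(u ^ m)) → ∃ z : K, z ≠ 0 ∧ (((A : K) + (B : K) * α) / (n : K) = ((u : NumberField.RingOfIntegers K) : K) * z ^ 3 ∨ ((A : K) + (B : K) * α) / (n : K) = ((u⁻¹ : (NumberField.RingOfIntegers K)ˣ) : NumberField.RingOfIntegers K) * z ^ 3)) ∧ ∀ (A' B' : ℤ) (n' : ℕ), (0 < n' ∧ ∀ (K : Type) [Field K] [NumberField K], Module.finrank ℚ K = 2 → ∀ α : K, α ^ 2 = (s : K) → ∀ u : (NumberField.RingOfIntegers K)ˣ,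 (∀ v : (NumberField.RingOfIntegers K)ˣ, ∃ m : ℤ, v = u ^ m ∨ v = -(u ^ m)) → ∃ z : K, z ≠ 0 ∧ (((A' : K) + (B' : K) * α) / (n' : K) = ((u : NumberField.RingOfIntegers K) : K) * z ^ 3 ∨ ((A' : K) + (B' : K) * α) / (n' : K) = ((u⁻¹ : (NumberField.RingOfIntegers K)ˣ) : NumberField.RingOfIntegers K) * z ^ 3)) → (|A| + |B| + n < |A'| + |B'| + n' ∨ (|A| + |B| + n = |A'| + |B'| + n' ∧ (A < A' ∨ (A = A' ∧ (B < B' ∨ (B = B' ∧ n ≤ n'))))))) → f (Literature.Computability.Complexity.boolPair (Computability.encodeNat s) (Computability.encodeNat r)) = Computability.encodeNat n) →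
    (∃ g ∈ Literature.Computability.Complexity.FP, ∀ (s r : ℕ), Squarefree s → 1 < s → (∀ (K : Type) [Field K] [NumberField K], Module.finrank ℚ K = 2 → (∃ α : K, α ^ 2 = (s : K)) → |NumberField.Units.regulator K - (r : ℝ)| ≤ 1) → ∀ (A B : ℤ) (n : ℕ), ((0 < n ∧ ∀ (K : Type) [Field K] [NumberField K], Module.finrank ℚ K = 2 → ∀ α : K, α ^ 2 = (s : K) → ∀ u : (NumberField.RingOfIntegers K)ˣ, (∀ v : (NumberField.RingOfIntegers K)ˣ, ∃ m : ℤ, v = u ^ m ∨ v = -(u ^ m)) → ∃ z : K, z ≠ 0 ∧ (((A : K) + (B : K) * α) / (n : K) = ((u : NumberField.RingOfIntegers K) : K) * z ^ 3 ∨ ((A : K) + (B : K) * α) / (n : K) = ((u⁻¹ : (NumberField.RingOfIntegers K)ˣ) : NumberField.RingOfIntegers K) * z ^ 3)) ∧ ∀ (A' B' : ℤ) (n' : ℕ), (0 < n' ∧ ∀ (K : Type) [Field K] [NumberField K], Module.finrank ℚ K = 2 → ∀ α : K, α ^ 2 = (s : K) → ∀ u : (NumberField.RingOfIntegers K)ˣ,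 (∀ v : (NumberField.RingOfIntegers K)ˣ, ∃ m : ℤ, v = u ^ m ∨ v = -(u ^ m)) → ∃ z : K, z ≠ 0 ∧ (((A' : K) + (B' : K) * α) / (n' : K) = ((u : NumberField.RingOfIntegers K) : K) * z ^ 3 ∨ ((A' : K) + (B' : K) * α) / (n' : K) = ((u⁻¹ : (NumberField.RingOfIntegers K)ˣ) : NumberField.RingOfIntegers K) * z ^ 3)) → (|A| + |B| + n < |A'| + |B'| + n' ∨ (|A| + |B| + n = |A'| + |B'| + n' ∧ (A < A' ∨ (A = A' ∧ (B < B' ∨ (B = B' ∧ n ≤ n'))))))) → (∃ b : ℕ, Squarefree b ∧ b ∣ 2 * s ∧ (n = b ^ 2 ∨ n = 2 * b ^ 2)) → g (Literature.Computability.Complexity.boolPair (Literature.Computability.Complexity.boolPair (Computability.encodeNat s) (Computability.encodeNat r)) (Computability.encodeNat n)) = Literature.Computability.Complexity.boolPair (Literature.Computability.Complexity.boolPair (Computability.encodeNat A.natAbs) (Computability.encodeNat B.natAbs)) (Literature.Computability.Complexity.boolPair (Computability.encodeNat n) [decide (A < 0), decide (B < 0)])) →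
    Summit.QuantumAdvantage.QuantumAdvantage.Theses.RegulatorThird.OneThirdFP := by
  intro h0 h1 h2
  obtain ⟨f, hf, hfspec⟩ := h1
  obtain ⟨g, hg, hgspec⟩ := h2
  -- the composite machine  z ↦ g ⟨z, f z⟩
  refine ⟨g ∘ fanoutFn id f, comp_mem_FP hg (fanoutFn_mem_FP (PolyTimeComputable.id _) hf), ?_⟩
  intro s r hs h1s hreg A B n hleast
  -- (ii): the inner machine outputs the denominator of the least triple
  have e1 := hfspec s r hs h1s hreg A B n hleast
  -- (i): that denominator has the ramified shape, discharging the advice promise of (iii)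
  have e0 := h0 s hs h1s A B n hleast
  -- (iii): the outer machine outputs the least triple
  have e2 := hgspec s r hs h1s hreg A B n hleast e0
  show g (fanoutFn id f (boolPair (Computability.encodeNat s) (Computability.encodeNat r))) = _
  rw [fanoutFn_apply, id, e1]
  exact e2

end Summit.QuantumAdvantage.QuantumAdvantage.Theorems
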